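import Summits.HodgeConjecture.HodgeConjecture.Theses.NikulinTwinTransport
import Literature.AlgebraicGeometry.HodgeTheory.ComplexGysinRational
import Literature.AlgebraicGeometry.HodgeTheory.ComplexGysinOrientation
import Literature.AlgebraicGeometry.HodgeTheory.GysinKernelProofs
import Literature.AlgebraicGeometry.HodgeTheory.RationalClassesRingChange
import Literature.AlgebraicGeometry.HodgeTheory.RationalLatticeIntegral
import Literature.AlgebraicGeometry.HodgeTheory.ComplexConjugation
import Literature.AlgebraicGeometry.Motives.ComplexPointsOrientation
import Literature.AlgebraicTopology.SingularHomology.GysinMapOrientationChange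
import Literature.AlgebraicTopology.SingularHomology.UniversalCoefficientsField

/-!
# Orientation twists: the `∀ μ : OrientationFamily` quantifier versus INTEGER multiples of Gysin images

Negative-side helper library for crux `NikulinSerreCarrier` (stmt-HodgeConjecture-14464, route
NikulinTwinTransport; standing disprover, cdisprove gen 3).  Consumers: `Negative/TypedCruxFalse`
(the typed transcription of the crux is false for every Chern character theory at the twisted family) and
`Negative/StubModularTwinAddressFalse` (same for the registered stub `stub_modularTwinAddress`).

The route's statements take the orientation family as a parameter, `∀ μ : OrientationFamily,
μ.HasPoincareDuality → …`, the tree's idiom for the Gysin morphisms `complexGysin μ` (Fulton, Young Tableaux,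
App. B (5): `f_* = PD⁻¹ ∘ f(ℂ)_* ∘ PD`).  But `OrientationFamily` is an ARBITRARY choice of a `ℂ`-orientation of
each closed manifold `X(ℂ)`, Poincaré duality holds for every such choice (`OrientationFamily.hasPoincareDuality`),
and `complexGysin μ` rescales by `λ_Y / λ_X` when `[Y(ℂ)]`, `[X(ℂ)]` are rescaled by `λ_Y`, `λ_X`
(`gysinMap_eq_smul_of_fundamentalClass_eq`).  Statements invariant under `ℂˣ`-rescaling of Gysin images
(membership in `ℂ`-subspaces such as `algebraicClasses`, `∃ γ ∈ algebraicClasses …, φ = [γ]_*`) are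
insensitive to `μ`; statements asking for an INTEGER (or rational, or real) non-zero multiple,
`[c]_*^μ = (−m) • Ψ` with `m : ℤ`, are not.  This file builds the witness family:

* `unitSmul u μ` — an orientation rescaled by a unit, `[M]_{u•μ} = u • [M]_μ` (`fundamentalClass_unitSmul`);
* `ratFamily` — a RATIONALLY NORMALISED family: `[X(ℂ)]_{rat} = ι_*[X(ℂ)]_ℚ` for a chosen `ℚ`-orientation
  (`fundamentalClass_ratFamily`); its Gysin morphisms ARE the rational Gysin morphisms on rational classes
  (`complexGysin_ratFamily_ringChange`, scalar `u = 1` in `complexGysin_ringChange_eq_smul_gysinMap`), hence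
  preserve rational classes (`isRationalClass_complexGysin_ratFamily`);
* `twistFamily` — `[X(ℂ)]_{tw} = I ^ (dim X / 2) • [X(ℂ)]_{rat}`; then
  `complexGysin twistFamily = (twist (dim Y) · (twist (dim X))⁻¹) • complexGysin ratFamily`
  (`complexGysin_twistFamily`), i.e. `= I • complexGysin ratFamily` whenever `dim Y = dim X + 2`
  (`complexGysin_twistFamily_of_add_two`, `…_of_two_add`: the projections `X ⊗ Y′ ⟶ X`, `X ⊗ M ⟶ M` of the
  crux and its stubs);
* `eq_zero_of_I_smul_eq_smul` — `I • ρ = r • q` with `ρ, q` rational, `conj r = r ≠ 0` forces `q = 0`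
  (rational classes are real, `IsRationalClass.conjClass_eq`);
* `exists_ne_zero_smul_of_orientationFamily` — soundness of the repair: a non-zero COMPLEX multiple clause
  transfers between any two families;
* `exists_isIntegralClass_ne_zero_top` — `H²ⁿ(X(ℂ); ℂ)` has a non-zero INTEGRAL class for `X` smooth
  projective of dimension `n` (rational fundamental class ≠ 0, universal coefficients over `ℚ`, integral
  multiples of rational classes).

Everything is PROVED (no named facts used beyond the tree's proved theorems; axioms `propext`,
`Classical.choice`, `Quot.sound`).

## References

* [FultonYoungTableaux1997] W. Fulton, Young Tableaux, CUP 1997, App. B §B.1 (4)–(5).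
* [HatcherAT2002] A. Hatcher, Algebraic Topology, CUP 2002, §3.1 Thm. 3.2, §3.3 p. 235, Thm. 3.26, Thm. 3.30.
* [VoisinHodgeI2002] C. Voisin, Hodge Theory and Complex Algebraic Geometry I, CUP 2002, Cor. 6.12, §7.1.1, §7.3.2.
-/

noncomputable section

open CategoryTheory AlgebraicGeometry
open Literature.AlgebraicTopology.SingularHomology
open Literature.AlgebraicGeometry Literature.AlgebraicGeometry.HodgeTheory
open Literature.AlgebraicGeometry.Motives

namespace Summit.HodgeConjecture.HodgeConjecture.Theorems.NikulinSerreCarrier.Negative.OrientationTwist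

universe u v

/-! ### Scaling an orientation by a unit -/

/-- The orientation `x ↦ u • μₓ` for a unit `u`. [cite: HatcherAT2002, §3.3 p. 235] -/
def unitSmul {R : Type v} [CommRing R] {M : Type u} [TopologicalSpace M] {d : ℕ} (u : Rˣ)
    (μ : HomologicalOrientation R M d) : HomologicalOrientation R M d where
  localClass x := (u : R) • μ.localClass x
  isGenerator x := by
    obtain ⟨e, he⟩ := μ.isGenerator x
    refine ⟨e.trans (DistribMulAction.toLinearEquiv R R u⁻¹), ?_⟩
    simp [he, Units.smul_def]
  locallyConsistent x := by
    obtain ⟨K, hK, μK, hμK⟩ := μ.locallyConsistent x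
    exact ⟨K, hK, (u : R) • μK, fun y hy ↦ by rw [map_smul, hμK y hy]⟩

/-- `(u • μ)ₓ = u • μₓ`. [cite: HatcherAT2002, §3.3 p. 235] -/
@[simp]
theorem unitSmul_localClass {R : Type v} [CommRing R] {M : Type u} [TopologicalSpace M] {d : ℕ}
    (u : Rˣ) (μ : HomologicalOrientation R M d) (x : M) :
    (unitSmul u μ).localClass x = (u : R) • μ.localClass x := rfl

/-- `[M]_{u • μ} = u • [M]_μ` on a closed connected manifold. [cite: HatcherAT2002, §3.3 Thm. 3.26] -/
theorem fundamentalClass_unitSmul {R : Type v} [CommRing R] {M : Type u} [TopologicalSpace M]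
    {d : ℕ} [CompactSpace M] [T2Space M] [ChartedSpace (EuclideanSpace ℝ (Fin d)) M]
    [ConnectedSpace M] (u : Rˣ) (μ : HomologicalOrientation R M d) :
    (unitSmul u μ).fundamentalClass = (u : R) • μ.fundamentalClass := by
  obtain ⟨u', hu', hloc⟩ := μ.exists_unit_fundamentalClass_eq_smul (unitSmul u μ)
  obtain ⟨x₀⟩ := (inferInstance : Nonempty M)
  obtain ⟨e, he⟩ := μ.isGenerator x₀
  have h1 := hloc x₀
  rw [unitSmul_localClass] at h1
  have h2 := congrArg e h1
  rw [map_smul, map_smul, he, smul_eq_mul, smul_eq_mul, mul_one, mul_one] at h2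
  rw [hu', ← h2]

variable {n m : ℕ} {X Y : SchemeOver ℂ}

/-! ### A rationally normalised orientation family and its twist by `I ^ (dim / 2)` -/

/-- A chosen `ℚ`-orientation of `X(ℂ)`. [cite: HatcherAT2002, §3.3 p. 235] -/
def ratOr (hX : IsSmoothProjective n X) : HomologicalOrientation ℚ (ComplexPoints X) (2 * n) :=
  Classical.choice (ComplexPoints.isOrientableOver ℚ hX)

/-- A chosen `ℂ`-orientation of `X(ℂ)` (to be rescaled). [cite: HatcherAT2002, §3.3 p. 235] -/
def auxOr (hX : IsSmoothProjective n X) : HomologicalOrientation ℂ (ComplexPoints X) (2 * n) :=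
  Classical.choice (ComplexPoints.isOrientableOver ℂ hX)

/-- The auxiliary family `X ↦ auxOr`. [cite: FultonYoungTableaux1997, Appendix B §B.1 (4)] -/
def auxFamily : OrientationFamily := fun _ _ hX ↦ auxOr hX

/-- `ι_*[X(ℂ)]_ℚ = c • [X(ℂ)]_{aux}` for some `c ≠ 0`. [cite: HatcherAT2002, §3.3 Thm. 3.26] -/
theorem exists_scalar (hX : IsSmoothProjective n X) :
    ∃ c : ℂ, c ≠ 0 ∧
      singularHomology.coeffChange (ComplexPoints X) (algebraMap ℚ ℂ).toAddMonoidHom (2 * n)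
        (ratOr hX).fundamentalClass = c • (auxOr hX).fundamentalClass :=
  exists_coeffChange_fundamentalClass_eq_smul auxFamily hX (ratOr hX)

/-- The scalar `c_X ≠ 0` with `ι_*[X(ℂ)]_ℚ = c_X • [X(ℂ)]_{aux}`. [cite: HatcherAT2002, §3.3 Thm. 3.26] -/
def scalar (hX : IsSmoothProjective n X) : ℂ := (exists_scalar hX).choose

/-- `c_X ≠ 0`. [cite: HatcherAT2002, §3.3 Thm. 3.26] -/
theorem scalar_ne_zero (hX : IsSmoothProjective n X) : scalar hX ≠ 0 := (exists_scalar hX).choose_spec.1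

/-- `ι_*[X(ℂ)]_ℚ = c_X • [X(ℂ)]_{aux}`. [cite: HatcherAT2002, §3.3 Thm. 3.26] -/
theorem scalar_spec (hX : IsSmoothProjective n X) :
    singularHomology.coeffChange (ComplexPoints X) (algebraMap ℚ ℂ).toAddMonoidHom (2 * n)
        (ratOr hX).fundamentalClass = scalar hX • (auxOr hX).fundamentalClass :=
  (exists_scalar hX).choose_spec.2

/-- **The rationally normalised orientation family**: `[X(ℂ)]_{rat} = ι_*[X(ℂ)]_ℚ` for every smooth
projective `X` (the complex-ified rational fundamental class). [cite: VoisinHodgeI2002, §7.3.2] -/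
def ratFamily : OrientationFamily := fun _ _ hX ↦ unitSmul (Units.mk0 (scalar hX) (scalar_ne_zero hX)) (auxOr hX)

/-- **`[X(ℂ)]_{rat} = ι_*[X(ℂ)]_ℚ`.** [cite: VoisinHodgeI2002, §7.3.2] -/
theorem fundamentalClass_ratFamily (hX : IsSmoothProjective n X) :
    (ratFamily hX).fundamentalClass =
      singularHomology.coeffChange (ComplexPoints X) (algebraMap ℚ ℂ).toAddMonoidHom (2 * n)
        (ratOr hX).fundamentalClass := by
  letI := hX.chartedSpace
  haveI := ComplexPoints.compactSpace_of_isSmoothProjective hX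
  haveI := ComplexPoints.t2Space_of_isSmoothProjective hX
  haveI := connectedSpace_complexPoints hX
  change (unitSmul _ (auxOr hX)).fundamentalClass = _
  rw [fundamentalClass_unitSmul, Units.val_mk0, scalar_spec]

/-- The twist scalar `I ^ (d / 2)` in (complex) dimension `d`. [folklore] -/
def twist (d : ℕ) : ℂ := Complex.I ^ (d / 2)

/-- `twist d ≠ 0`. [folklore] -/
theorem twist_ne_zero (d : ℕ) : twist d ≠ 0 := pow_ne_zero _ Complex.I_ne_zero

/-- `twist (d + 2) = I · twist d`. [folklore] -/
theorem twist_add_two (d : ℕ) : twist (d + 2) = Complex.I * twist d := by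
  unfold twist
  rw [show (d + 2) / 2 = d / 2 + 1 by omega, pow_succ, mul_comm]

/-- `twist (d + 2) · (twist d)⁻¹ = I`. [folklore] -/
theorem twist_add_two_mul_inv (d : ℕ) : twist (d + 2) * (twist d)⁻¹ = Complex.I := by
  rw [twist_add_two, mul_assoc, mul_inv_cancel₀ (twist_ne_zero d), mul_one]

/-- **The twisted family**: `[X(ℂ)]_{tw} = I ^ (dim X / 2) • ι_*[X(ℂ)]_ℚ` — an orientation family like any
other (Poincaré duality holds for it, `OrientationFamily.hasPoincareDuality`). [folklore] -/
def twistFamily : OrientationFamily := fun d _ hX ↦ unitSmul (Units.mk0 (twist d) (twist_ne_zero d)) (ratFamily hX)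

/-- `[X(ℂ)]_{tw} = twist (dim X) • [X(ℂ)]_{rat}`. [folklore] -/
theorem fundamentalClass_twistFamily (hX : IsSmoothProjective n X) :
    (twistFamily hX).fundamentalClass = twist n • (ratFamily hX).fundamentalClass := by
  letI := hX.chartedSpace
  haveI := ComplexPoints.compactSpace_of_isSmoothProjective hX
  haveI := ComplexPoints.t2Space_of_isSmoothProjective hX
  haveI := connectedSpace_complexPoints hX
  change (unitSmul _ (ratFamily hX)).fundamentalClass = _
  rw [fundamentalClass_unitSmul, Units.val_mk0]

/-! ### Gysin morphisms for the two families -/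

/-- **`complexGysin ratFamily` on rational classes IS the rational Gysin morphism** (scalar `u = 1`).
[cite: FultonYoungTableaux1997, Appendix B §B.1 (5)] [cite: VoisinHodgeI2002, §7.3.2] -/
theorem complexGysin_ratFamily_ringChange (hY : IsSmoothProjective m Y) (hX : IsSmoothProjective n X)
    (f : Y ⟶ X) {a b q : ℕ} (ha : a + q = 2 * m) (hb : b + q = 2 * n)
    (y : singularCohomology ℚ ℚ (ComplexPoints Y) a) :
    complexGysin ratFamily hY hX f (show a + 2 * n = b + 2 * m by omega)
        (singularCohomology.ringChange (algebraMap ℚ ℂ) (ComplexPoints Y) a y) =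
      singularCohomology.ringChange (algebraMap ℚ ℂ) (ComplexPoints X) b
        (gysinMap (ratOr hY) (ratOr hX) (AlgPoints.mapContinuous (L := ℂ) f) ha hb y) := by
  have hμ : ratFamily.HasPoincareDuality := OrientationFamily.hasPoincareDuality _
  have hνX : (ratOr hX).HasPoincareDuality := by
    letI := hX.chartedSpace
    haveI := ComplexPoints.compactSpace_of_isSmoothProjective hX
    haveI := ComplexPoints.t2Space_of_isSmoothProjective hX
    exact HomologicalOrientation.HasPoincareDuality.of_bijective_poincareDualityMap
      (fun p q h ↦ poincare_duality _ h)
  have e1 : capProduct hb (singularCohomology.ringChange (algebraMap ℚ ℂ) (ComplexPoints X) b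
        (gysinMap (ratOr hY) (ratOr hX) (AlgPoints.mapContinuous (L := ℂ) f) ha hb y))
      (singularHomology.coeffChange (ComplexPoints X) (algebraMap ℚ ℂ).toAddMonoidHom (2 * n)
        (ratOr hX).fundamentalClass) =
      singularHomology.map ℂ ℂ (AlgPoints.mapContinuous (L := ℂ) f) q
        (capProduct ha (singularCohomology.ringChange (algebraMap ℚ ℂ) (ComplexPoints Y) a y)
          (singularHomology.coeffChange (ComplexPoints Y) (algebraMap ℚ ℂ).toAddMonoidHom
            (2 * m) (ratOr hY).fundamentalClass)) := by
    rw [← singularHomology.coeffChange_capProduct, capProduct_gysinMap hνX _ ha hb y,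
      singularHomology.coeffChange_map, singularHomology.coeffChange_capProduct]
  rw [← fundamentalClass_ratFamily hX, ← fundamentalClass_ratFamily hY] at e1
  apply (hμ hX hb).1
  rw [poincareDualityMap_apply, poincareDualityMap_apply, capProduct_complexGysin hμ hY hX f _ ha hb,
    e1]

/-- Hence `complexGysin ratFamily` maps rational classes to rational classes.
[cite: VoisinHodgeI2002, §7.3.2] -/
theorem isRationalClass_complexGysin_ratFamily (hY : IsSmoothProjective m Y)
    (hX : IsSmoothProjective n X) (f : Y ⟶ X) {a b : ℕ} (hab : a + 2 * n = b + 2 * m)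
    {w : complexBetti Y a} (hw : IsRationalClass w) :
    IsRationalClass (complexGysin ratFamily hY hX f hab w) := by
  by_cases h : a ≤ 2 * m
  · obtain ⟨y, rfl⟩ := hw.exists_ringChange_eq
    rw [complexGysin_ratFamily_ringChange hY hX f (q := 2 * m - a) (by omega) (by omega)]
    exact isRationalClass_ringChange _
  · rw [complexGysin_of_lt hY hX f hab (not_le.1 h), LinearMap.zero_apply]
    exact IsRationalClass.zero

/-- **The twisted Gysin morphism**: `complexGysin twistFamily = (twist (dim Y) · (twist (dim X))⁻¹) •
complexGysin ratFamily`. [cite: FultonYoungTableaux1997, Appendix B §B.1 (5)] -/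
theorem complexGysin_twistFamily (hY : IsSmoothProjective m Y) (hX : IsSmoothProjective n X)
    (f : Y ⟶ X) {a b : ℕ} (hab : a + 2 * n = b + 2 * m) :
    complexGysin twistFamily hY hX f hab =
      (twist m * (twist n)⁻¹) • complexGysin ratFamily hY hX f hab := by
  have hμ : ratFamily.HasPoincareDuality := OrientationFamily.hasPoincareDuality _
  have hμ' : twistFamily.HasPoincareDuality := OrientationFamily.hasPoincareDuality _
  by_cases h : a ≤ 2 * m
  · rw [complexGysin_eq_gysinMap hY hX f hab (q := 2 * m - a) (by omega) (by omega),
      complexGysin_eq_gysinMap hY hX f hab (q := 2 * m - a) (by omega) (by omega)]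
    exact gysinMap_eq_smul_of_fundamentalClass_eq (hμ hX) (hμ' hX) (fundamentalClass_twistFamily hY)
      (fundamentalClass_twistFamily hX)
      (by rw [mul_comm (twist m), ← mul_assoc, mul_inv_cancel₀ (twist_ne_zero n), one_mul]) _ _ _
  · rw [complexGysin_of_lt hY hX f hab (not_le.1 h), complexGysin_of_lt hY hX f hab (not_le.1 h),
      smul_zero]

/-- **Codimension-two case**: for `dim Y = dim X + 2` (e.g. `fst : X ⊗ Y′ ⟶ X`, `snd : X ⊗ M ⟶ M` with
surfaces `X`, `Y′`), `complexGysin twistFamily = I • complexGysin ratFamily`. [folklore] -/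
theorem complexGysin_twistFamily_of_add_two (hY : IsSmoothProjective (n + 2) Y)
    (hX : IsSmoothProjective n X) (f : Y ⟶ X) {a b : ℕ} (hab : a + 2 * n = b + 2 * (n + 2)) :
    complexGysin twistFamily hY hX f hab = Complex.I • complexGysin ratFamily hY hX f hab := by
  rw [complexGysin_twistFamily, twist_add_two_mul_inv]

/-- `twist (2 + d) = I · twist d` (the spelling `2 + k` of `IsSmoothProjective.tensor_holds`). [folklore] -/
theorem twist_two_add (d : ℕ) : twist (2 + d) = Complex.I * twist d := by
  rw [add_comm, twist_add_two]

/-- **Codimension-two case, spelling `2 + dim`** (`snd : X ⊗ M ⟶ M` for a surface `X`,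
`IsSmoothProjective.tensor_holds hX hM : IsSmoothProjective (2 + k) (X ⊗ M)`):
`complexGysin twistFamily = I • complexGysin ratFamily`. [folklore] -/
theorem complexGysin_twistFamily_of_two_add (hY : IsSmoothProjective (2 + n) Y)
    (hX : IsSmoothProjective n X) (f : Y ⟶ X) {a b : ℕ} (hab : a + 2 * n = b + 2 * (2 + n)) :
    complexGysin twistFamily hY hX f hab = Complex.I • complexGysin ratFamily hY hX f hab := by
  rw [complexGysin_twistFamily, twist_two_add, mul_assoc, mul_inv_cancel₀ (twist_ne_zero n), mul_one]

/-! ### The repaired clause (`m : ℂ`) is insensitive to the orientation family -/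

/-- **Soundness of the repair `m : ℂ`.**  If, for ONE orientation family `μ` (with Poincaré duality), a Gysin
image is a non-zero COMPLEX multiple of a given map — `∀ w, f_*^μ (L w) = m • T w`, `m ≠ 0` — then the same
holds for EVERY other family `μ'` (with `m' = c·m`, `f_*^{μ'} = c • f_*^μ`, `c ≠ 0`,
`complexGysin_eq_smul_of_orientationFamily`).  So `∃ m : ℂ, m ≠ 0 ∧ …` under `∀ μ` is equivalent to the same
clause for the complex orientation, whereas `∃ m : ℤ` is not (`Negative/TypedCruxFalse`).
[cite: FultonYoungTableaux1997, Appendix B §B.1 (5)] -/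
theorem exists_ne_zero_smul_of_orientationFamily {μ μ' : OrientationFamily} (hμ : μ.HasPoincareDuality)
    (hμ' : μ'.HasPoincareDuality) (hY : IsSmoothProjective m Y) (hX : IsSmoothProjective n X) (f : Y ⟶ X)
    {a b : ℕ} (hab : a + 2 * n = b + 2 * m) {W : Type*} (L : W → complexBetti Y a) (T : W → complexBetti X b)
    (h : ∃ c : ℂ, c ≠ 0 ∧ ∀ w, complexGysin μ hY hX f hab (L w) = c • T w) :
    ∃ c : ℂ, c ≠ 0 ∧ ∀ w, complexGysin μ' hY hX f hab (L w) = c • T w := by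
  obtain ⟨c, hc, hcw⟩ := h
  obtain ⟨u, hu, hu'⟩ := complexGysin_eq_smul_of_orientationFamily hμ hμ' hY hX f hab
  exact ⟨u * c, mul_ne_zero hu hc, fun w ↦ by rw [hu', LinearMap.smul_apply, hcw, smul_smul]⟩

/-! ### Rational classes: `I • ρ = r • q` forces `q = 0` -/

/-- If `ρ`, `q` are rational classes, `r` is a real (`conj r = r`) non-zero scalar and `I • ρ = r • q`,
then `q = 0` (apply complex conjugation, which fixes rational classes). [cite: VoisinHodgeI2002, Cor. 6.12] -/
theorem eq_zero_of_I_smul_eq_smul {T : Type u} [TopologicalSpace T] {k : ℕ}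
    {ρ q : singularCohomology ℂ ℂ T k} (hρ : IsRationalClass ρ) (hq : IsRationalClass q)
    {r : ℂ} (hr : starRingEnd ℂ r = r) (hr0 : r ≠ 0) (h : Complex.I • ρ = r • q) : q = 0 := by
  have h1 := congrArg (conjClass T k) h
  rw [conjClass_smul, conjClass_smul, hρ.conjClass_eq, hq.conjClass_eq, Complex.conj_I, hr, ← h,
    neg_smul] at h1
  have h2 : Complex.I • ρ = 0 := by
    have h3 : (2 : ℂ) • (Complex.I • ρ) = 0 := by
      rw [two_smul]
      nth_rewrite 1 [← h1]
      exact neg_add_cancel _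
    exact (smul_eq_zero.1 h3).resolve_left two_ne_zero
  rw [h2] at h
  exact (smul_eq_zero.1 h.symm).resolve_left hr0

/-! ### A non-zero integral class of top degree -/

/-- **`H²ⁿ(X(ℂ); ℂ)` contains a non-zero integral class** for `X` smooth projective of dimension `n`:
the rational fundamental class `[X(ℂ)]_ℚ ≠ 0` is detected by a functional, i.e. (universal
coefficients over `ℚ`) by a class `c ∈ H²ⁿ(X(ℂ); ℚ)`; `ι c ≠ 0` is rational, and a positive integer
multiple of it is integral. [cite: HatcherAT2002, §3.1 Thm. 3.2 and §3.3 Thm. 3.26] -/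
theorem exists_isIntegralClass_ne_zero_top (hX : IsSmoothProjective n X) :
    ∃ p : complexBetti X (2 * n), IsIntegralClass p ∧ p ≠ 0 := by
  letI := hX.chartedSpace
  haveI := ComplexPoints.compactSpace_of_isSmoothProjective hX
  haveI := ComplexPoints.t2Space_of_isSmoothProjective hX
  haveI := connectedSpace_complexPoints hX
  have hν : (ratOr hX).fundamentalClass ≠ 0 := fundamentalClass_ne_zero (ratOr hX)
  obtain ⟨φ, hφ⟩ : ∃ φ : Module.Dual ℚ (singularHomology ℚ ℚ (ComplexPoints X) (2 * n)),
      φ (ratOr hX).fundamentalClass ≠ 0 :=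
    not_forall.1 fun hcon ↦ hν ((Module.forall_dual_apply_eq_zero_iff ℚ _).1 hcon)
  obtain ⟨c, hc⟩ := (kroneckerPairing_bijective_of_field ℚ (ComplexPoints X) (2 * n)).2 φ
  have hc0 : c ≠ 0 := by
    rintro rfl
    apply hφ
    rw [← hc, map_zero, LinearMap.zero_apply]
  have hq : IsRationalClass (singularCohomology.ringChange (algebraMap ℚ ℂ) (ComplexPoints X) (2 * n) c) :=
    isRationalClass_ringChange c
  have hq0 : singularCohomology.ringChange (algebraMap ℚ ℂ) (ComplexPoints X) (2 * n) c ≠ 0 := by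
    intro h0
    apply hc0
    apply ringChange_rat_injective
    rw [h0, map_zero]
  obtain ⟨N, hN, hint⟩ := hq.exists_nsmul_isIntegralClass hX
  exact ⟨_, hint, smul_ne_zero (Nat.cast_ne_zero.2 hN.ne') hq0⟩

end Summit.HodgeConjecture.HodgeConjecture.Theorems.NikulinSerreCarrier.Negative.OrientationTwist

end
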